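import Literature.NumberTheory.Automorphic.BockleHuiIrreducibleGL3WeightProofs
import HarnessLib

/-!
# `ReducibleForcesEssSelfDual` (route `IrreducibilityBySelfDuality`, item stmt-Langlands-13619) —
# the analytic exclusion of three characters among the Satake parameters

Helper file (`--supports stmt-Langlands-13619`) for clause (2) of the support item
`ReducibleForcesEssSelfDual`: the automorphic half of "a semisimple `r` compatible with a CUSPIDAL
`π` on `GL_3` never has three linearly independent stable lines".  After the Galois-side dictionary
(`…ReducibleForcesEssSelfDualThreeLines`: `t_{π,v} = {μ₀(ϖ_v), μ₁(ϖ_v), μ₂(ϖ_v)}` a.e. for three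
Hecke characters `μ_i`) the statement is about `π` alone and is the "three characters" case of
Böckle–Hui 2025, §3.2.1, run in the Borel–Jacquet model of the tree exactly as the analytic case of
that section is in `BockleHuiIrreducibleGL3AnalyticProofs` / `…WeightProofs`:

* *Weights* (`norm_prod_satake_eq_norm_cube_of_JS`, proved in the tree from the contragredient
  datum and Jacquet–Shalika): `‖∏ t_{π,v}‖ = ‖μ_i(ϖ_v)‖³` for each `i`, so the three characters have
  the same absolute value at almost every place; with `|μ₀| = ‖·‖^σ` and `λ = ‖·‖^{-σ}` the twists
  `θ_i = λ μ_i` are unitary a.e. and `π₀ = π ⊗ λ` has the unitary Satake family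
  `β_w = {θ₀, θ₁, θ₂}(ϖ_w)`.
* *Euler factors* (`satakePairPolynomial_three_lines`): `det(1 - β_w θ₀(ϖ_w)⁻¹ T) =
  (1 - T)(1 - (θ₁/θ₀)(ϖ_w) T)(1 - (θ₂/θ₀)(ϖ_w) T)`, i.e.
  `L^S(s, π₀ × θ₀⁻¹) = ζ_F^S(s) · L^S(s, θ₁/θ₀) · L^S(s, θ₂/θ₀)`.
* *Poles* (`false_of_JS_of_eulerIdentity_three`): by Jacquet–Shalika (2.2) for Borel–Jacquet data
  (the route's input `PairLBoundaryJS`, `3 ≠ 1`) the left-hand side has a finite limit at `s = 1⁺`;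
  `(s - 1) ζ_F^S(s) → c₀ ≠ 0` (Hecke, `tendsto_sub_one_mul_partialPairL_one_one`, a theorem); and each
  `L^S(s, θ_j/θ₀)` either tends to a non-zero limit ((2.2) off the `X`-condition) or IS `ζ_F^S`
  for `S` large (on it) — `exists_pow_mul_partialPairL_tendsto_of_glOne`: `(s-1)^{k_j} L^S → d_j ≠ 0`
  with `k_j ∈ {0, 1}`.  Multiplying by `(s - 1)^{1 + k₂ + k₃}`: `0 = c₀ d₂ d₃ ≠ 0`.
* `false_of_satake_eq_three_heckeCharacters` — the assembled statement about `π`.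

Inputs: Jacquet–Shalika (2.2) for Borel–Jacquet data (`JacquetShalika1981_partialPairL_boundary_repData`,
a hypothesis — the route's input item) and the contragredient datum on `GL_3` (hypothesis);
(2.1) (`JacquetShalika1981_multipliable_partialPairL_repData_holds`) and the pole of `ζ_F^S` are
theorems of the tree.

References: G. Böckle, C.-Y. Hui, Math. Ann. 393 (2025), §3.2.1 (arXiv:2404.08954, p. 13);
J. Arthur, L. Clozel, Ann. of Math. Stud. 120, Ch. 3 §2 (2.1)–(2.3); H. Jacquet, J. Shalika,
Amer. J. Math. 103 (1981).
-/

noncomputable section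

set_option linter.dupNamespace false -- project-wide option (lakefile weak.linter.dupNamespace); `Summit.Langlands.Langlands` is the mandated namespace

open scoped Topology Classical NumberField
open NumberField IsDedekindDomain Filter Polynomial
open Literature.NumberTheory.Automorphic
open Literature.NumberTheory.GaloisRepresentations (HeckeCharacter ideleGroup localUnits)

namespace Summit.Langlands.Langlands.Theorems.ReducibleForcesEssSelfDual

/-! ### Bookkeeping on Hecke characters at uniformizers -/

section Bookkeeping

variable {F : Type} [Field F] [NumberField F]

/-- `χ(ϖ_v)` is the value of `χ` at the idele `(…, 1, ϖ_v, 1, …)`. [folklore] -/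
private theorem a_vAU_apply (χ : HeckeCharacter F) (v : HeightOneSpectrum (𝓞 F)) :
    χ.valueAtUniformizer v =
      ((χ (localUnits v (Literature.NumberTheory.GaloisRepresentations.HeckeCharacter.uniformizer F v)) :
        ℂˣ) : ℂ) := by
  simp only [Literature.NumberTheory.GaloisRepresentations.HeckeCharacter.valueAtUniformizer,
    Literature.NumberTheory.GaloisRepresentations.HeckeCharacter.localComponent_apply]

/-- `(χ₁ χ₂)(ϖ_v) = χ₁(ϖ_v) χ₂(ϖ_v)`. [folklore] -/
private theorem a_vAU_mul (χ₁ χ₂ : HeckeCharacter F) (v : HeightOneSpectrum (𝓞 F)) :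
    (χ₁ * χ₂).valueAtUniformizer v = χ₁.valueAtUniformizer v * χ₂.valueAtUniformizer v := by
  simp only [a_vAU_apply, Literature.NumberTheory.GaloisRepresentations.HeckeCharacter.mul_apply,
    Units.val_mul]

/-- `χ⁻¹(ϖ_v) = χ(ϖ_v)⁻¹`. [folklore] -/
private theorem a_vAU_inv (χ : HeckeCharacter F) (v : HeightOneSpectrum (𝓞 F)) :
    χ⁻¹.valueAtUniformizer v = (χ.valueAtUniformizer v)⁻¹ := by
  simp only [a_vAU_apply, Literature.NumberTheory.GaloisRepresentations.HeckeCharacter.inv_apply,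
    Units.val_inv_eq_inv_val]

/-- `χ(ϖ_v) ≠ 0`. [folklore] -/
private theorem a_vAU_ne_zero (χ : HeckeCharacter F) (v : HeightOneSpectrum (𝓞 F)) :
    χ.valueAtUniformizer v ≠ 0 := by
  rw [a_vAU_apply]
  exact Units.ne_zero _

end Bookkeeping

/-! ### The Euler-factor identity for three characters -/

section Algebra

/-- **Euler factors of `π₀ × θ₀⁻¹` when `t_{π₀} = {θ₀, θ₁, θ₂}`.**  For `θ₀ ≠ 0`:
`det(1 - {θ₀, θ₁, θ₂} ⊗ {θ₀⁻¹} T) = (1 - T) · (1 - θ₀⁻¹θ₁ T) · (1 - θ₀⁻¹θ₂ T)`, i.e. factor by factor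
`L(s, π₀ × θ₀⁻¹) = ζ(s) L(s, θ₁/θ₀) L(s, θ₂/θ₀)` — the "three characters" instance of the `L`-function
identities of Böckle–Hui §3.2.1. [cite: BockleHui2025, §3.2.1] -/
theorem satakePairPolynomial_three_lines (θ₀ θ₁ θ₂ : ℂ) (hθ₀ : θ₀ ≠ 0) :
    satakePairPolynomial {θ₀, θ₁, θ₂} {θ₀⁻¹} =
      satakePairPolynomial {1} {1} * satakePairPolynomial {θ₀⁻¹ * θ₁} {1} *
        satakePairPolynomial {θ₀⁻¹ * θ₂} {1} := by
  simp only [satakePairPolynomial_eq_eulerPolynomial, satakeTensor_comm _ {θ₀⁻¹},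
    satakeTensor_singleton_one_right, satakeTensor_singleton_left, Multiset.insert_eq_cons,
    Multiset.map_cons, Multiset.map_singleton, eulerPolynomial_cons, inv_mul_cancel₀ hθ₀]
  simp only [eulerPolynomial, Multiset.map_singleton, Multiset.prod_singleton]
  ring

end Algebra

/-! ### Partial `L`-functions: a three-factor identity, and the GL(1) factors -/

section Analytic

variable {F : Type} [Field F] [NumberField F]

/-- **An identity of partial `L`-functions from an identity of Euler factors** (three factors on
the right): if off `S` `P(p, q) = P(a, b) P(a', b') P(a'', b'')` for the Rankin–Selberg polynomials
and the three Euler products on the right are multipliable at `s`, then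
`L^S(s, p ⊗ q) = L^S(s, a ⊗ b) L^S(s, a' ⊗ b') L^S(s, a'' ⊗ b'')`. [folklore] -/
theorem partialPairL_eq_mul_mul_of_satakePairPolynomial_eq {S : Set (HeightOneSpectrum (𝓞 F))}
    {p q a b a' b' a'' b'' : SatakeFamily F}
    (hId : ∀ v ∉ S, satakePairPolynomial (p v) (q v) =
      satakePairPolynomial (a v) (b v) * satakePairPolynomial (a' v) (b' v) *
        satakePairPolynomial (a'' v) (b'' v))
    {s : ℂ}
    (hab : Multipliable fun v : {v : HeightOneSpectrum (𝓞 F) // v ∉ S} =>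
      ((satakePairPolynomial (a v.1) (b v.1)).eval ((v.1.residueCard : ℂ) ^ (-s)))⁻¹)
    (hab' : Multipliable fun v : {v : HeightOneSpectrum (𝓞 F) // v ∉ S} =>
      ((satakePairPolynomial (a' v.1) (b' v.1)).eval ((v.1.residueCard : ℂ) ^ (-s)))⁻¹)
    (hab'' : Multipliable fun v : {v : HeightOneSpectrum (𝓞 F) // v ∉ S} =>
      ((satakePairPolynomial (a'' v.1) (b'' v.1)).eval ((v.1.residueCard : ℂ) ^ (-s)))⁻¹) :
    partialPairL S p q s = partialPairL S a b s * partialPairL S a' b' s * partialPairL S a'' b'' s := by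
  unfold partialPairL
  rw [← hab.tprod_mul hab', ← (hab.mul hab').tprod_mul hab'']
  congr 1
  funext v
  rw [← mul_inv, ← mul_inv, ← eval_mul, ← eval_mul, hId v.1 v.2]

/-- **The partial `L`-function of a unitary GL(1) datum against the trivial one has at worst a
simple pole at `s = 1`, and a non-zero leading term.**  Granting Jacquet–Shalika (2.2) for
Borel–Jacquet data: for cuspidal GL(1) data `τ`, `τ₀` with Satake families `t`, `{1}` off a finite
`T` (`t` unitary), there is a finite `S₀ ⊇ T` such that for every finite `S ⊇ S₀`,
`(s - 1)^k L^S(s, t × 1) → d ≠ 0` as `s → 1`, `Re s > 1`, for some `k ∈ {0, 1}`: off the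
`X`-condition of (2.2) (`t_w ≠ 1` infinitely often) `k = 0` by (2.2); on it (`t_w = 1` for almost
all `w`) `L^S(s, t × 1) = ζ_F^S(s)` once `S` contains the exceptions, and `k = 1` by Hecke's theorem
(`tendsto_sub_one_mul_partialPairL_one_one`).  Arthur–Clozel Ch. 3 §2 (2.2)–(2.3) for `GL(1) × GL(1)`.
[cite: ArthurClozelAMS120, Ch. 3 §2 (2.2)–(2.3)] -/
theorem exists_pow_mul_partialPairL_tendsto_of_glOne
    (hJ2 : JacquetShalika1981_partialPairL_boundary_repData)
    {h1 : isCompact_glFiniteIntegralLevel 1 F} (τ τ₀ : CuspidalAutomorphicRepData 1 F h1)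
    (t one : SatakeFamily F) (hone : ∀ w, one w = {1}) {T : Set (HeightOneSpectrum (𝓞 F))}
    (hT : T.Finite) (hτ : ∀ w ∉ T, τ.1.HasSatakeParamAt w (t w))
    (hτ₀ : ∀ w ∉ T, τ₀.1.HasSatakeParamAt w (one w)) (hu : ∀ w ∉ T, ‖(t w).prod‖ = 1) :
    ∃ S₀ : Set (HeightOneSpectrum (𝓞 F)), S₀.Finite ∧ T ⊆ S₀ ∧
      ∀ {S : Set (HeightOneSpectrum (𝓞 F))}, S.Finite → S₀ ⊆ S →
        ∃ (k : ℕ) (d : ℂ), d ≠ 0 ∧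
          Tendsto (fun s => (s - 1) ^ k * partialPairL S t one s) (𝓝[{s : ℂ | 1 < s.re}] 1) (𝓝 d) := by
  by_cases hX : ∀ᶠ w : HeightOneSpectrum (𝓞 F) in cofinite,
      (t w).map ((((w.residueCard : ℂ)) ^ ((1 : ℂ) - 1)) * ·) = (one w).map (·⁻¹)
  · -- on the `X`-condition: `t w = {1}` for almost all `w`, and `L^S(s, t × 1) = ζ_F^S(s)`
    have hX' : ∀ᶠ w : HeightOneSpectrum (𝓞 F) in cofinite, t w = one w := by
      filter_upwards [hX] with w hw
      rw [hone] at hw ⊢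
      simpa [sub_self, Complex.cpow_zero] using hw
    refine ⟨T ∪ {w | ¬ t w = one w}, hT.union (Filter.eventually_cofinite.1 hX'),
      Set.subset_union_left, fun {S} hS hS₀ => ?_⟩
    obtain ⟨c₀, hc₀, hZ⟩ := tendsto_sub_one_mul_partialPairL_one_one hS hone
    refine ⟨1, c₀, hc₀, ?_⟩
    have heq : partialPairL S t one = partialPairL S one one := by
      funext s
      unfold partialPairL
      congr 1
      funext v
      have hv : t v.1 = one v.1 := not_not.1 fun h => v.2 (hS₀ (Or.inr h))
      rw [hv]
    simpa only [pow_one, heq] using hZ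
  · -- off the `X`-condition: (2.2) gives a finite non-zero limit
    obtain ⟨S₁, hS₁, hJ⟩ := hJ2 1 1 F h1 h1 one_pos one_pos τ τ₀
    refine ⟨T ∪ S₁, hT.union hS₁, Set.subset_union_left, fun {S} hS hS₀ => ?_⟩
    have hTS : ∀ w ∉ S, w ∉ T := fun w hw hwT => hw (hS₀ (Or.inl hwT))
    obtain ⟨c, hc, h⟩ := hJ hS (Set.subset_union_right.trans hS₀) (fun w hw => hτ w (hTS w hw))
      (fun w hw => hτ₀ w (hTS w hw)) (fun w hw => hu w (hTS w hw))
      (fun w _ => by rw [hone]; simp) Complex.one_re (fun h' => hX h'.2)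
    exact ⟨0, c, hc, by simpa only [pow_zero, one_mul] using h⟩

/-- **The pole count of the "three characters" case** (Böckle–Hui §3.2.1 / Arthur–Clozel (2.1)–(2.3)
in the Borel–Jacquet model).  Granting Jacquet–Shalika (2.2) for Borel–Jacquet data: let `τ₀`, `τ₁`,
`τ₂`, `τ₃` be cuspidal GL(1) data and `P` a cuspidal datum on `GL(3)` whose Satake families off a
finite `T` are `{1}`, `t₁`, `t₂`, `t₃`, `β`, all unitary, with the Euler-factor identity
`P(β, t₁) = P(1, 1) P(t₂, 1) P(t₃, 1)` off `T` (i.e. `L^S(s, P × τ₁) = ζ_F^S(s) L^S(s, τ₂) L^S(s, τ₃)`).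
Contradiction: the left-hand side has a finite limit at `s = 1⁺` ((2.2), `3 ≠ 1`), `(s - 1) ζ_F^S(s)
→ c₀ ≠ 0` (Hecke), and `(s - 1)^{k_j} L^S(s, τ_j) → d_j ≠ 0` (`k_j ∈ {0,1}`,
`exists_pow_mul_partialPairL_tendsto_of_glOne`); multiplying the identity by `(s - 1)^{1+k₂+k₃}`
gives `0 = c₀ d₂ d₃`. [cite: BockleHui2025, §3.2.1] [cite: ArthurClozelAMS120, Ch. 3 §2 (2.1)–(2.3)] -/
theorem false_of_JS_of_eulerIdentity_three
    (hJ2 : JacquetShalika1981_partialPairL_boundary_repData)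
    {h1 : isCompact_glFiniteIntegralLevel 1 F} {h3 : isCompact_glFiniteIntegralLevel 3 F}
    (τ₀ τ₁ τ₂ τ₃ : CuspidalAutomorphicRepData 1 F h1) (P : CuspidalAutomorphicRepData 3 F h3)
    (one t₁ t₂ t₃ β : SatakeFamily F) {T : Set (HeightOneSpectrum (𝓞 F))} (hT : T.Finite)
    (hone : ∀ w, one w = {1})
    (hτ₀ : ∀ w ∉ T, τ₀.1.HasSatakeParamAt w (one w)) (hτ₁ : ∀ w ∉ T, τ₁.1.HasSatakeParamAt w (t₁ w))
    (hτ₂ : ∀ w ∉ T, τ₂.1.HasSatakeParamAt w (t₂ w)) (hτ₃ : ∀ w ∉ T, τ₃.1.HasSatakeParamAt w (t₃ w))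
    (hP : ∀ w ∉ T, P.1.HasSatakeParamAt w (β w))
    (hu₁ : ∀ w ∉ T, ‖(t₁ w).prod‖ = 1) (hu₂ : ∀ w ∉ T, ‖(t₂ w).prod‖ = 1)
    (hu₃ : ∀ w ∉ T, ‖(t₃ w).prod‖ = 1) (huβ : ∀ w ∉ T, ‖(β w).prod‖ = 1)
    (hId : ∀ w ∉ T, satakePairPolynomial (β w) (t₁ w) =
      satakePairPolynomial (one w) (one w) * satakePairPolynomial (t₂ w) (one w) *
        satakePairPolynomial (t₃ w) (one w)) : False := by
  -- the exceptional sets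
  have hJ1 := JacquetShalika1981_multipliable_partialPairL_repData_holds
  obtain ⟨S₁, hS₁, hJ1a⟩ := hJ1 1 1 F h1 h1 one_pos one_pos τ₀ τ₀
  obtain ⟨S₂, hS₂, hJ1b⟩ := hJ1 1 1 F h1 h1 one_pos one_pos τ₂ τ₀
  obtain ⟨S₃, hS₃, hJ1c⟩ := hJ1 1 1 F h1 h1 one_pos one_pos τ₃ τ₀
  obtain ⟨S₄, hS₄, hJ2a⟩ := hJ2 3 1 F h3 h1 (by norm_num) one_pos P τ₁
  obtain ⟨S₅, hS₅, -, hA₂⟩ :=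
    exists_pow_mul_partialPairL_tendsto_of_glOne hJ2 τ₂ τ₀ t₂ one hone hT hτ₂ hτ₀ hu₂
  obtain ⟨S₆, hS₆, -, hA₃⟩ :=
    exists_pow_mul_partialPairL_tendsto_of_glOne hJ2 τ₃ τ₀ t₃ one hone hT hτ₃ hτ₀ hu₃
  set S : Set (HeightOneSpectrum (𝓞 F)) := T ∪ S₁ ∪ S₂ ∪ S₃ ∪ S₄ ∪ S₅ ∪ S₆ with hS_def
  have hS : S.Finite := (((((hT.union hS₁).union hS₂).union hS₃).union hS₄).union hS₅).union hS₆
  have hTS : ∀ w ∉ S, w ∉ T := fun w hw hwT => hw (by simp [hS_def, hwT])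
  have sub₁ : S₁ ⊆ S := fun x hx => by simp [hS_def, hx]
  have sub₂ : S₂ ⊆ S := fun x hx => by simp [hS_def, hx]
  have sub₃ : S₃ ⊆ S := fun x hx => by simp [hS_def, hx]
  have sub₄ : S₄ ⊆ S := fun x hx => by simp [hS_def, hx]
  have sub₅ : S₅ ⊆ S := fun x hx => by simp [hS_def, hx]
  have sub₆ : S₆ ⊆ S := fun x hx => by simp [hS_def, hx]
  -- the hypotheses off `S`
  have hτ₀S : ∀ w ∉ S, τ₀.1.HasSatakeParamAt w (one w) := fun w hw => hτ₀ w (hTS w hw)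
  have hτ₁S : ∀ w ∉ S, τ₁.1.HasSatakeParamAt w (t₁ w) := fun w hw => hτ₁ w (hTS w hw)
  have hτ₂S : ∀ w ∉ S, τ₂.1.HasSatakeParamAt w (t₂ w) := fun w hw => hτ₂ w (hTS w hw)
  have hτ₃S : ∀ w ∉ S, τ₃.1.HasSatakeParamAt w (t₃ w) := fun w hw => hτ₃ w (hTS w hw)
  have hPS : ∀ w ∉ S, P.1.HasSatakeParamAt w (β w) := fun w hw => hP w (hTS w hw)
  have huone : ∀ w ∉ S, ‖(one w).prod‖ = 1 := fun w _ => by rw [hone]; simp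
  have hu₁S : ∀ w ∉ S, ‖(t₁ w).prod‖ = 1 := fun w hw => hu₁ w (hTS w hw)
  have hu₂S : ∀ w ∉ S, ‖(t₂ w).prod‖ = 1 := fun w hw => hu₂ w (hTS w hw)
  have hu₃S : ∀ w ∉ S, ‖(t₃ w).prod‖ = 1 := fun w hw => hu₃ w (hTS w hw)
  have huβS : ∀ w ∉ S, ‖(β w).prod‖ = 1 := fun w hw => huβ w (hTS w hw)
  -- (2.1): multipliability on `Re s > 1`
  have m11 : ∀ s : ℂ, 1 < s.re → Multipliable fun v : {v : HeightOneSpectrum (𝓞 F) // v ∉ S} =>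
      ((satakePairPolynomial (one v.1) (one v.1)).eval ((v.1.residueCard : ℂ) ^ (-s)))⁻¹ :=
    fun s hs => hJ1a hS sub₁ hτ₀S hτ₀S huone huone hs
  have m2 : ∀ s : ℂ, 1 < s.re → Multipliable fun v : {v : HeightOneSpectrum (𝓞 F) // v ∉ S} =>
      ((satakePairPolynomial (t₂ v.1) (one v.1)).eval ((v.1.residueCard : ℂ) ^ (-s)))⁻¹ :=
    fun s hs => hJ1b hS sub₂ hτ₂S hτ₀S hu₂S huone hs
  have m3 : ∀ s : ℂ, 1 < s.re → Multipliable fun v : {v : HeightOneSpectrum (𝓞 F) // v ∉ S} =>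
      ((satakePairPolynomial (t₃ v.1) (one v.1)).eval ((v.1.residueCard : ℂ) ^ (-s)))⁻¹ :=
    fun s hs => hJ1c hS sub₃ hτ₃S hτ₀S hu₃S huone hs
  -- (2.2) for `(P, τ₁)`: `L^S(s, P × τ₁) → c₁` (`3 ≠ 1`, so `X = ∅`)
  obtain ⟨c₁, -, hF⟩ := hJ2a hS sub₄ hPS hτ₁S huβS hu₁S Complex.one_re
    (fun h => absurd h.1 (by norm_num))
  -- the GL(1) factors and Hecke's theorem
  obtain ⟨k₂, d₂, hd₂, hL₂⟩ := hA₂ hS sub₅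
  obtain ⟨k₃, d₃, hd₃, hL₃⟩ := hA₃ hS sub₆
  obtain ⟨c₀, hc₀, hZ⟩ := tendsto_sub_one_mul_partialPairL_one_one hS hone
  -- the identity of `L`-functions on `Re s > 1`
  have hEq : ∀ᶠ s in 𝓝[{s : ℂ | 1 < s.re}] 1, partialPairL S β t₁ s =
      partialPairL S one one s * partialPairL S t₂ one s * partialPairL S t₃ one s :=
    eventually_nhdsWithin_of_forall fun s hs =>
      partialPairL_eq_mul_mul_of_satakePairPolynomial_eq (fun v hv => hId v (hTS v hv))
        (m11 s hs) (m2 s hs) (m3 s hs)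
  -- both limits of `(s - 1)^{1 + k₂ + k₃} L^S(s, P × τ₁)`
  have hlhs : Tendsto (fun s => (s - 1) ^ (1 + k₂ + k₃) * partialPairL S β t₁ s)
      (𝓝[{s : ℂ | 1 < s.re}] 1) (𝓝 0) := by
    have h := (tendsto_sub_one_nhdsWithin_one_lt_re.pow (1 + k₂ + k₃)).mul hF
    rwa [zero_pow (by omega), zero_mul] at h
  have hrhs : Tendsto (fun s => (s - 1) ^ (1 + k₂ + k₃) * partialPairL S β t₁ s)
      (𝓝[{s : ℂ | 1 < s.re}] 1) (𝓝 (c₀ * d₂ * d₃)) := by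
    refine ((hZ.mul hL₂).mul hL₃).congr' ?_
    filter_upwards [hEq] with s hs
    rw [hs]
    ring
  exact mul_ne_zero (mul_ne_zero hc₀ hd₂) hd₃ (tendsto_nhds_unique hrhs hlhs)

end Analytic

/-! ### The statement about `π`: three Hecke characters cannot fill the Satake parameters of a
cuspidal `π` on `GL(3)` -/

section Construction

variable {F : Type} [Field F] [NumberField F]

/-- **A cuspidal `π` on `GL_3(𝔸_F)` is not, at Satake level, a sum of three Hecke characters.**
Granting Jacquet–Shalika (2.2) for Borel–Jacquet data and the contragredient datum on `GL(3)`: if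
`μ₀, μ₁, μ₂` are Hecke characters with `t_{π,v} = {μ₀(ϖ_v), μ₁(ϖ_v), μ₂(ϖ_v)}` for every Satake
parameter of `π` at almost every `v`, contradiction.  Proof (Böckle–Hui §3.2.1, the case of three
characters; Jacquet–Shalika's classification): the weights agree
(`norm_prod_satake_eq_norm_cube_of_JS`: `‖∏ t_{π,v}‖ = ‖μ_i(ϖ_v)‖³` for each `i`), so after the
unitary normalisation `θ_i = ‖·‖^{-σ} μ_i` (`|μ₀| = ‖·‖^σ`), `π₀ = π ⊗ ‖·‖^{-σ}`
(`exists_twist_hecke_hasSatakeParamAt`) the data `τ₀ = 1`, `τ₁ = θ₀⁻¹`, `τ₂ = θ₁/θ₀`, `τ₃ = θ₂/θ₀`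
(GL(1) data of Hecke characters, `exists_cuspidal_glOne_hasSatakeParamAt_valueAtUniformizer`) and
`P = π₀` satisfy `L^S(s, π₀ × θ₀⁻¹) = ζ_F^S(s) L^S(s, θ₁/θ₀) L^S(s, θ₂/θ₀)` factor by factor
(`satakePairPolynomial_three_lines`), which `false_of_JS_of_eulerIdentity_three` excludes.
[cite: BockleHui2025, §3.2.1] [cite: ArthurClozelAMS120, Ch. 3 §2 (2.2)] -/
theorem false_of_satake_eq_three_heckeCharacters
    (hJ2 : JacquetShalika1981_partialPairL_boundary_repData)
    {h3 : isCompact_glFiniteIntegralLevel 3 F}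
    (hC : CuspidalAutomorphicRepData.exists_contragredient_satake h3)
    (π : CuspidalAutomorphicRepData 3 F h3) (μ₀ μ₁ μ₂ : HeckeCharacter F)
    (hμ : ∀ᶠ v : HeightOneSpectrum (𝓞 F) in cofinite, ∀ α : Multiset ℂ, π.1.HasSatakeParamAt v α →
      α = {μ₀.valueAtUniformizer v, μ₁.valueAtUniformizer v, μ₂.valueAtUniformizer v}) : False := by
  have h1 : isCompact_glFiniteIntegralLevel 1 F := isCompact_glFiniteIntegralLevel_holds 1 F
  -- weights: `‖μ_i(ϖ_v)‖ = ‖μ₀(ϖ_v)‖` at almost every `v`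
  have hpin : ∀ μ : HeckeCharacter F,
      (∀ᶠ v : HeightOneSpectrum (𝓞 F) in cofinite, ∀ α : Multiset ℂ, π.1.HasSatakeParamAt v α →
        μ.valueAtUniformizer v ∈ α) →
      ∀ᶠ v : HeightOneSpectrum (𝓞 F) in cofinite, ∀ α : Multiset ℂ,
        π.1.HasSatakeParamAt v α → ‖α.prod‖ = ‖μ.valueAtUniformizer v‖ ^ 3 :=
    fun μ hμ' => norm_prod_satake_eq_norm_cube_of_JS hC π hμ'
  have hpin₀ := hpin μ₀ (hμ.mono fun v hv α hα => by rw [hv α hα]; simp)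
  have hpin₁ := hpin μ₁ (hμ.mono fun v hv α hα => by rw [hv α hα]; simp)
  have hpin₂ := hpin μ₂ (hμ.mono fun v hv α hα => by rw [hv α hα]; simp)
  have hcube : ∀ {a b : ℝ}, 0 ≤ a → 0 ≤ b → a ^ 3 = b ^ 3 → a = b := fun ha hb h =>
    (pow_left_inj₀ ha hb (by norm_num)).1 h
  have hnorm : ∀ᶠ v : HeightOneSpectrum (𝓞 F) in cofinite,
      ‖μ₁.valueAtUniformizer v‖ = ‖μ₀.valueAtUniformizer v‖ ∧
        ‖μ₂.valueAtUniformizer v‖ = ‖μ₀.valueAtUniformizer v‖ := by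
    filter_upwards [π.1.hasSatakeParamAt_cofinite_holds, hpin₀, hpin₁, hpin₂] with v hv h₀ h₁' h₂'
    obtain ⟨α, hα⟩ := hv
    exact ⟨hcube (norm_nonneg _) (norm_nonneg _) ((h₁' α hα).symm.trans (h₀ α hα)),
      hcube (norm_nonneg _) (norm_nonneg _) ((h₂' α hα).symm.trans (h₀ α hα))⟩
  -- the unitary normalisation: `|μ₀| = ‖·‖^σ`, `lam = ‖·‖^{-σ}`, `θ_i = lam μ_i`
  obtain ⟨σ, hσ⟩ := μ₀.exists_norm_apply_eq_ideleNorm_rpow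
  obtain ⟨lam, hlam⟩ := exists_heckeCharacter_ideleNorm_cpow F ((-σ : ℝ) : ℂ)
  have hθu : ∀ x : ideleGroup F, ‖((lam x : ℂˣ) : ℂ)‖ * ‖((μ₀ x : ℂˣ) : ℂ)‖ = 1 := by
    intro x
    have hN : (0 : ℝ) < Literature.NumberTheory.GaloisRepresentations.ideleNorm x :=
      Literature.NumberTheory.GaloisRepresentations.HeckeCharacter.ideleNorm_pos' F x
    rw [hlam x, Complex.norm_cpow_eq_rpow_re_of_pos hN, Complex.ofReal_re, hσ x,
      ← Real.rpow_add hN, neg_add_cancel, Real.rpow_zero]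
  set θ₀ : HeckeCharacter F := lam * μ₀ with hθ₀def
  set θ₁ : HeckeCharacter F := lam * μ₁ with hθ₁def
  set θ₂ : HeckeCharacter F := lam * μ₂ with hθ₂def
  have hθ₀1 : ∀ w : HeightOneSpectrum (𝓞 F), ‖θ₀.valueAtUniformizer w‖ = 1 := fun w => by
    rw [hθ₀def, a_vAU_mul, norm_mul, a_vAU_apply, a_vAU_apply]
    exact hθu _
  have hθ1 : ∀ᶠ w : HeightOneSpectrum (𝓞 F) in cofinite,
      ‖θ₁.valueAtUniformizer w‖ = 1 ∧ ‖θ₂.valueAtUniformizer w‖ = 1 := by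
    filter_upwards [hnorm] with w hw
    refine ⟨?_, ?_⟩
    · rw [← hθ₀1 w, hθ₁def, hθ₀def, a_vAU_mul, a_vAU_mul, norm_mul, norm_mul, hw.1]
    · rw [← hθ₀1 w, hθ₂def, hθ₀def, a_vAU_mul, a_vAU_mul, norm_mul, norm_mul, hw.2]
  -- the data `P = π ⊗ lam`, `τ₀ = 1`, `τ₁ = θ₀⁻¹`, `τ₂ = θ₀⁻¹ θ₁`, `τ₃ = θ₀⁻¹ θ₂`
  obtain ⟨P, hP⟩ := CuspidalAutomorphicRepData.exists_twist_hecke_hasSatakeParamAt lam π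
  obtain ⟨τ₀, hτ₀⟩ := exists_cuspidal_glOne_hasSatakeParamAt_one h1
  obtain ⟨τ₁, hτ₁⟩ := exists_cuspidal_glOne_hasSatakeParamAt_valueAtUniformizer h1 θ₀⁻¹
  obtain ⟨τ₂, hτ₂⟩ := exists_cuspidal_glOne_hasSatakeParamAt_valueAtUniformizer h1 (θ₀⁻¹ * θ₁)
  obtain ⟨τ₃, hτ₃⟩ := exists_cuspidal_glOne_hasSatakeParamAt_valueAtUniformizer h1 (θ₀⁻¹ * θ₂)
  -- the Satake family `β_w = {θ₀, θ₁, θ₂}(ϖ_w)` of `P` and the good places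
  set β : SatakeFamily F := fun w =>
    {θ₀.valueAtUniformizer w, θ₁.valueAtUniformizer w, θ₂.valueAtUniformizer w} with hβdef
  have hPβ : ∀ᶠ w : HeightOneSpectrum (𝓞 F) in cofinite, P.1.HasSatakeParamAt w (β w) := by
    filter_upwards [π.1.hasSatakeParamAt_cofinite_holds, hμ, hP] with w hw hμw hPw
    obtain ⟨α, hα⟩ := hw
    have h := hPw α hα
    rw [hμw α hα] at h
    simpa only [hβdef, hθ₀def, hθ₁def, hθ₂def, a_vAU_mul, Multiset.insert_eq_cons, Multiset.map_cons,
      Multiset.map_singleton] using h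
  have hgood : ∀ᶠ w : HeightOneSpectrum (𝓞 F) in cofinite,
      (‖θ₁.valueAtUniformizer w‖ = 1 ∧ ‖θ₂.valueAtUniformizer w‖ = 1) ∧ P.1.HasSatakeParamAt w (β w) ∧
      τ₀.1.HasSatakeParamAt w {1} ∧ τ₁.1.HasSatakeParamAt w {θ₀⁻¹.valueAtUniformizer w} ∧
      τ₂.1.HasSatakeParamAt w {(θ₀⁻¹ * θ₁).valueAtUniformizer w} ∧
      τ₃.1.HasSatakeParamAt w {(θ₀⁻¹ * θ₂).valueAtUniformizer w} := by
    filter_upwards [hθ1, hPβ, hτ₀, hτ₁, hτ₂, hτ₃] with w h1w hPw h0w h1w' h2w h3w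
    exact ⟨h1w, hPw, h0w, h1w', h2w, h3w⟩
  obtain ⟨T, hT, hgoodT⟩ : ∃ T : Set (HeightOneSpectrum (𝓞 F)), T.Finite ∧ ∀ w ∉ T,
      (‖θ₁.valueAtUniformizer w‖ = 1 ∧ ‖θ₂.valueAtUniformizer w‖ = 1) ∧ P.1.HasSatakeParamAt w (β w) ∧
      τ₀.1.HasSatakeParamAt w {1} ∧ τ₁.1.HasSatakeParamAt w {θ₀⁻¹.valueAtUniformizer w} ∧
      τ₂.1.HasSatakeParamAt w {(θ₀⁻¹ * θ₁).valueAtUniformizer w} ∧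
      τ₃.1.HasSatakeParamAt w {(θ₀⁻¹ * θ₂).valueAtUniformizer w} :=
    ⟨_, Filter.eventually_cofinite.1 hgood, fun w hw => not_not.1 hw⟩
  -- conclude by the pole count
  refine false_of_JS_of_eulerIdentity_three hJ2 τ₀ τ₁ τ₂ τ₃ P (fun _ => {1})
    (fun w => {θ₀⁻¹.valueAtUniformizer w}) (fun w => {(θ₀⁻¹ * θ₁).valueAtUniformizer w})
    (fun w => {(θ₀⁻¹ * θ₂).valueAtUniformizer w}) β hT (fun _ => rfl)
    (fun w hw => (hgoodT w hw).2.2.1) (fun w hw => (hgoodT w hw).2.2.2.1)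
    (fun w hw => (hgoodT w hw).2.2.2.2.1) (fun w hw => (hgoodT w hw).2.2.2.2.2)
    (fun w hw => (hgoodT w hw).2.1) (fun w hw => ?_) (fun w hw => ?_) (fun w hw => ?_) (fun w hw => ?_)
    (fun w hw => ?_)
  · rw [Multiset.prod_singleton, a_vAU_inv, norm_inv, hθ₀1, inv_one]
  · rw [Multiset.prod_singleton, a_vAU_mul, a_vAU_inv, norm_mul, norm_inv, hθ₀1, (hgoodT w hw).1.1,
      inv_one, one_mul]
  · rw [Multiset.prod_singleton, a_vAU_mul, a_vAU_inv, norm_mul, norm_inv, hθ₀1, (hgoodT w hw).1.2,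
      inv_one, one_mul]
  · show ‖({θ₀.valueAtUniformizer w, θ₁.valueAtUniformizer w, θ₂.valueAtUniformizer w} : Multiset ℂ).prod‖ = 1
    rw [Multiset.insert_eq_cons, Multiset.prod_cons, Multiset.insert_eq_cons, Multiset.prod_cons,
      Multiset.prod_singleton, norm_mul, norm_mul, hθ₀1, (hgoodT w hw).1.1, (hgoodT w hw).1.2,
      one_mul, one_mul]
  · show satakePairPolynomial {θ₀.valueAtUniformizer w, θ₁.valueAtUniformizer w, θ₂.valueAtUniformizer w}
        {θ₀⁻¹.valueAtUniformizer w} = _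
    rw [a_vAU_mul θ₀⁻¹ θ₁, a_vAU_mul θ₀⁻¹ θ₂, a_vAU_inv θ₀]
    exact satakePairPolynomial_three_lines _ _ _ (a_vAU_ne_zero θ₀ w)

end Construction

end Summit.Langlands.Langlands.Theorems.ReducibleForcesEssSelfDual

end
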